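import Summits.QuantumAdvantage.QuantumAdvantage.Theorems.LinnikCubicClassGroupsDegreeOnePrimesEscapeClassPNTDHInputs
import Summits.QuantumAdvantage.QuantumAdvantage.Theorems.LinnikCubicClassGroupsDegreeOnePrimesEscapeClassPNTSmoothedMain
import HarnessLib

/-!
# The class prime number theorem with DECAYING error, II′: the Landau–Page package in `Q`-form

Topic `Summits/QuantumAdvantage/QuantumAdvantage/Theorems`, cell B2b-1 (linnik-cubic), PART A (gen 32);
helper toward the crux `DegreeOnePrimesEscape` (stmt-QuantumAdvantage-11543) of route
`LinnikCubicClassGroups`.  HONEST FRAMING: the value of this file is a THEOREM (kernel-checked) — NOT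
summit progress (the route still rests on the hypothesis-type target `PureCubicClassNumberHard`).

Three small consequences of the Landau–Page package `exists_exceptionalZero_const` (TZ2019 Thm. 3.1 for the
class group `L`-functions of a number field `K`, constant `c₀ = c₀(n)`), isolated from the proof of
`smoothedClassSum_dichotomy_dh` (`…ClassPNTDHSmoothed.lean`) for reuse in its decaying-error twin
(`…ClassPNTDHSmoothedDecay.lean`); `c ≤ c₀` is the (narrower) constant of the exceptional segment
`excRegion c K`, `Q = condQn K = |d_K| n^n`:

* `zfr_classical_Qform` — off the segment every zero `ρ = β + iγ` of the family `F_ψ` has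
  `β ≤ 1 − c/(a log Q + log(|γ| + 4))` (`a ≥ 1`; clause (1): zeros in the region are real);
* `exceptionalZero_facts` — a zero `ρ₁` of `F_{ψ₁}` ON the segment (with `c ≤ 1/(8(n² + 1))`) is real,
  `ρ₁ = β₁ ≥ 1/2`, its character is real, it is simple (`m_{ψ₁}(ρ₁) = 1`) and `L(β₁, χ_{ψ₁}) = 0`;
* `excUpdate_spec` — by clause (2) (uniqueness) the sets `Exc = update (fun _ ↦ ∅) ψ₁ {ρ₁}` contain every
  zero of the family on the segment, and `Σ_ψ ψ(C⁻¹) Σ_{ρ ∈ Exc ψ} m_ψ(ρ) Φ(ρ) = ψ₁(C⁻¹) Φ(ρ₁)`.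

Reference: J. Thorner, A. Zaman, Algebra Number Theory 13 (2019), Thm. 3.1 [ThornerZaman2019].
-/

noncomputable section

open Complex Real MeasureTheory Set Filter Topology
open scoped NumberField nonZeroDivisors

namespace Summit.QuantumAdvantage.QuantumAdvantage.Theorems.DegreeOnePrimesEscape

open Literature.NumberTheory.LFunctions Literature.NumberTheory.LFunctions.NumberField
  Literature.NumberTheory.LFunctions.EntireEF Literature.NumberTheory.LFunctions.TZWeight
  Literature.NumberTheory.LFunctions.AbelianDensity

variable {K : Type} [Field K] [NumberField K]

/-- **The classical zero-free region off the exceptional segment, in `Q`-form**: with the reality clause of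
the Landau–Page package at `c₀` and `c ≤ c₀`, `a ≥ 1`, every zero `ρ` of `F_ψ` off `excRegion c K` has
`Re ρ ≤ 1 − c/(a log Q + log(|Im ρ| + 4))` (`log|d_K| ≤ log Q ≤ a log Q`). [cite: ThornerZaman2019, Theorem 3.1] -/
theorem zfr_classical_Qform {c c₀ a : ℝ} (hc : 0 < c) (hcc₀ : c ≤ c₀) (ha : 1 ≤ a)
    (hLPreal : ∀ (χ : ClassGroup (𝓞 K) →* ℂˣ) (ρ : ℂ),
      (((χ = 1 → dedekindZeta₁ K ρ = 0) ∧ (χ ≠ 1 → classGroupLFunction₀ K χ ρ = 0)) ∧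
        1 - c₀ / (Real.log ((NumberField.discr K).natAbs : ℝ) + Real.log (|ρ.im| + 4)) < ρ.re) →
        ρ.im = 0 ∧ χ * χ = 1)
    (ψ : AddChar (Additive (ClassGroup (𝓞 K))) ℂ) {ρ : ℂ} (h0 : famF K ψ ρ = 0)
    (hexc : ¬ excRegion c K ρ) :
    ρ.re ≤ 1 - c / (a * Real.log (ThornerZaman.condQn K) + Real.log (|ρ.im| + 4)) := by
  have hpack_c : ∀ (χ : ClassGroup (𝓞 K) →* ℂˣ) (ρ : ℂ),
      (((χ = 1 → dedekindZeta₁ K ρ = 0) ∧ (χ ≠ 1 → classGroupLFunction₀ K χ ρ = 0)) ∧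
        1 - c / (Real.log ((NumberField.discr K).natAbs : ℝ) + Real.log (|ρ.im| + 4)) < ρ.re) →
        ρ.im = 0 ∧ χ * χ = 1 :=
    fun χ ρ h ↦ hLPreal χ ρ ⟨h.1, lpRegion_mono hcc₀ h.2⟩
  have h1 := re_le_of_not_excRegion hpack_c ψ h0 hexc
  set Q : ℝ := ThornerZaman.condQn K with hQ
  have hd1 : (1 : ℝ) ≤ ((NumberField.discr K).natAbs : ℝ) := by
    exact_mod_cast Nat.one_le_iff_ne_zero.2 (Int.natAbs_ne_zero.2 (NumberField.discr_ne_zero K))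
  have hQ1 : (1 : ℝ) ≤ Q := hd1.trans (natAbs_discr_le_condQn K)
  have hlogQ : 0 ≤ Real.log Q := Real.log_nonneg hQ1
  have hdQ : Real.log ((NumberField.discr K).natAbs : ℝ) ≤ a * Real.log Q := by
    have hd0 : (0 : ℝ) < ((NumberField.discr K).natAbs : ℝ) := by
      exact_mod_cast Nat.pos_of_ne_zero (Int.natAbs_ne_zero.2 (NumberField.discr_ne_zero K))
    have h2 := Real.log_le_log hd0 (natAbs_discr_le_condQn K)
    rw [← hQ] at h2; nlinarith
  have hlog4 : 0 < Real.log (|ρ.im| + 4) := Real.log_pos (by linarith [abs_nonneg ρ.im])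
  have hlogd : 0 ≤ Real.log ((NumberField.discr K).natAbs : ℝ) := Real.log_natCast_nonneg _
  have : c / (a * Real.log Q + Real.log (|ρ.im| + 4)) ≤
      c / (Real.log ((NumberField.discr K).natAbs : ℝ) + Real.log (|ρ.im| + 4)) :=
    div_le_div_of_nonneg_left hc.le (by linarith) (by linarith)
  linarith

/-- **A zero of the family on the exceptional segment is real, simple, belongs to a real character and
is a zero of `L(s, χ)`**: with the reality and simplicity clauses of the Landau–Page package at `c₀`,
`c ≤ c₀`, `c ≤ 1/(8(n² + 1))`, a zero `ρ₁` of `F_{ψ₁}` with `Re ρ₁ < 1` on `excRegion c K`: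
`ρ₁ = β₁ := Re ρ₁`, `χ_{ψ₁}² = 1`, `m_{ψ₁}(ρ₁) = 1`, `1/2 ≤ β₁`, `L(β₁, χ_{ψ₁}) = 0`, and `β₁` lies on the
segment. [cite: ThornerZaman2019, Theorem 3.1] -/
theorem exceptionalZero_facts {n : ℕ} (hn : 1 < n) {c c₀ : ℝ} (hcc₀ : c ≤ c₀)
    (hcn : c ≤ 1 / (8 * ((n : ℝ) ^ 2 + 1)))
    (hLPreal : ∀ (χ : ClassGroup (𝓞 K) →* ℂˣ) (ρ : ℂ),
      (((χ = 1 → dedekindZeta₁ K ρ = 0) ∧ (χ ≠ 1 → classGroupLFunction₀ K χ ρ = 0)) ∧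
        1 - c₀ / (Real.log ((NumberField.discr K).natAbs : ℝ) + Real.log (|ρ.im| + 4)) < ρ.re) →
        ρ.im = 0 ∧ χ * χ = 1)
    (hLPsimple : ∀ (χ : ClassGroup (𝓞 K) →* ℂˣ) (ρ : ℂ),
      (((χ = 1 → dedekindZeta₁ K ρ = 0) ∧ (χ ≠ 1 → classGroupLFunction₀ K χ ρ = 0)) ∧
        1 - c₀ / (Real.log ((NumberField.discr K).natAbs : ℝ) + Real.log (|ρ.im| + 4)) < ρ.re) →
        (χ = 1 → analyticOrderAt (dedekindZeta₁ K) ρ = 1) ∧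
          (χ ≠ 1 → analyticOrderAt (classGroupLFunction₀ K χ) ρ = 1))
    (ψ₁ : AddChar (Additive (ClassGroup (𝓞 K))) ℂ) {ρ₁ : ℂ} (h0₁ : famF K ψ₁ ρ₁ = 0)
    (hre₁' : ρ₁.re < 1) (hexc₁ : excRegion c K ρ₁) :
    ρ₁ = ((ρ₁.re : ℝ) : ℂ) ∧ (toMulHom ψ₁).toHomUnits * (toMulHom ψ₁).toHomUnits = 1 ∧
      famMult K ψ₁ ρ₁ = 1 ∧ 1 / 2 ≤ ρ₁.re ∧
      classGroupLFunction K (toMulHom ψ₁).toHomUnits ρ₁.re = 0 ∧ excRegion c K ((ρ₁.re : ℝ) : ℂ) := by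
  have hn2 : (2 : ℝ) ≤ n := by exact_mod_cast hn
  have hZ₁ : (((toMulHom ψ₁).toHomUnits = 1 → dedekindZeta₁ K ρ₁ = 0) ∧
      ((toMulHom ψ₁).toHomUnits ≠ 1 → classGroupLFunction₀ K (toMulHom ψ₁).toHomUnits ρ₁ = 0)) ∧
      1 - c₀ / (Real.log ((NumberField.discr K).natAbs : ℝ) + Real.log (|ρ₁.im| + 4)) < ρ₁.re := by
    refine ⟨famZ_of_famF_eq_zero ψ₁ h0₁, lpRegion_mono hcc₀ ?_⟩
    obtain ⟨him, hre⟩ := hexc₁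
    rw [him, abs_zero, zero_add]; exact hre
  obtain ⟨him₁, hreal₁⟩ := hLPreal _ ρ₁ hZ₁
  have hρ₁ : ρ₁ = ((ρ₁.re : ℝ) : ℂ) := by
    apply Complex.ext <;> simp [him₁]
  have hmult : famMult K ψ₁ ρ₁ = 1 := by
    obtain ⟨hs1, hs2⟩ := hLPsimple _ ρ₁ hZ₁
    by_cases hψ : ψ₁ = 0
    · subst hψ
      have h := hs1 toHomUnits_toMulHom_zero
      have hne : analyticOrderAt (dedekindZeta₁ K) ρ₁ ≠ ⊤ := by rw [h]; exact ENat.one_ne_top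
      have : (analyticOrderNatAt (dedekindZeta₁ K) ρ₁ : ℕ∞) = 1 := by
        rw [Nat.cast_analyticOrderNatAt hne, h]
      rw [famMult, famF_zero]; exact_mod_cast this
    · have h := hs2 (toHomUnits_ne_one hψ)
      have hne : analyticOrderAt (classGroupLFunction₀ K (toMulHom ψ₁).toHomUnits) ρ₁ ≠ ⊤ := by
        rw [h]; exact ENat.one_ne_top
      have : (analyticOrderNatAt (classGroupLFunction₀ K (toMulHom ψ₁).toHomUnits) ρ₁ : ℕ∞) = 1 := by
        rw [Nat.cast_analyticOrderNatAt hne, h]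
      rw [famMult, famF_of_ne hψ]; exact_mod_cast this
  have hβhalf : 1 / 2 ≤ ρ₁.re := by
    have hlog4 : 1 < Real.log 4 := by
      rw [show (4:ℝ) = 2 ^ 2 by norm_num, Real.log_pow]; have := Real.log_two_gt_d9; push_cast; linarith
    have hlogd : 0 ≤ Real.log ((NumberField.discr K).natAbs : ℝ) := Real.log_natCast_nonneg _
    have hc2 : c ≤ 1 / 2 :=
      hcn.trans (by rw [div_le_div_iff_of_pos_left one_pos (by positivity) (by norm_num)]; nlinarith)
    have : c / (Real.log ((NumberField.discr K).natAbs : ℝ) + Real.log 4) ≤ 1 / 2 := by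
      rw [div_le_iff₀ (by linarith)]; nlinarith
    linarith [hexc₁.2]
  have hβ1ne : ((ρ₁.re : ℝ) : ℂ) ≠ 1 := by
    intro h'; apply hre₁'.ne; exact_mod_cast h'
  have h0β : famF K ψ₁ ((ρ₁.re : ℝ) : ℂ) = 0 := by rw [← hρ₁]; exact h0₁
  have hLzero : classGroupLFunction K (toMulHom ψ₁).toHomUnits ρ₁.re = 0 :=
    classGroupLFunction_eq_zero_of_famF ψ₁ h0β hβ1ne
  have hexcβ : excRegion c K ((ρ₁.re : ℝ) : ℂ) := by rw [← hρ₁]; exact hexc₁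
  exact ⟨hρ₁, hreal₁, hmult, hβhalf, hLzero, hexcβ⟩

/-- **The exceptional set is a singleton**: with the uniqueness clause of the Landau–Page package at `c₀`
and `c ≤ c₀`, for a zero `ρ₁` of `F_{ψ₁}` on `excRegion c K` with `0 < Re ρ₁ < 1` and `m_{ψ₁}(ρ₁) = 1`,
the sets `Exc = update (fun _ ↦ ∅) ψ₁ {ρ₁}` consist of non-trivial zeros, contain every zero of the family
on the segment, and `Σ_ψ ψ(C⁻¹) Σ_{ρ ∈ Exc ψ} m_ψ(ρ) Φ(ρ) = ψ₁(C⁻¹) Φ(ρ₁)`. [cite: ThornerZaman2019, Theorem 3.1] -/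
theorem excUpdate_spec {c c₀ : ℝ} (hcc₀ : c ≤ c₀)
    (hLPuniq : ∀ (χ₁ χ₂ : ClassGroup (𝓞 K) →* ℂˣ) (ρ₁ ρ₂ : ℂ),
      (((χ₁ = 1 → dedekindZeta₁ K ρ₁ = 0) ∧ (χ₁ ≠ 1 → classGroupLFunction₀ K χ₁ ρ₁ = 0)) ∧
        1 - c₀ / (Real.log ((NumberField.discr K).natAbs : ℝ) + Real.log (|ρ₁.im| + 4)) < ρ₁.re) →
      (((χ₂ = 1 → dedekindZeta₁ K ρ₂ = 0) ∧ (χ₂ ≠ 1 → classGroupLFunction₀ K χ₂ ρ₂ = 0)) ∧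
        1 - c₀ / (Real.log ((NumberField.discr K).natAbs : ℝ) + Real.log (|ρ₂.im| + 4)) < ρ₂.re) →
        χ₁ = χ₂ ∧ ρ₁ = ρ₂)
    (ψ₁ : AddChar (Additive (ClassGroup (𝓞 K))) ℂ) {ρ₁ : ℂ} (h0₁ : famF K ψ₁ ρ₁ = 0) (hre₁ : 0 < ρ₁.re)
    (hre₁' : ρ₁.re < 1) (hexc₁ : excRegion c K ρ₁) (hmult : famMult K ψ₁ ρ₁ = 1) :
    (∀ ψ, ∀ ρ ∈ Function.update (fun _ ↦ (∅ : Finset ℂ)) ψ₁ {ρ₁} ψ,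
        famF K ψ ρ = 0 ∧ 0 < ρ.re ∧ ρ.re < 1) ∧
    (∀ ψ ρ, famF K ψ ρ = 0 → 0 < ρ.re → ρ.re < 1 → excRegion c K ρ →
        ρ ∈ Function.update (fun _ ↦ (∅ : Finset ℂ)) ψ₁ {ρ₁} ψ) ∧
    ∀ (Cl : ClassGroup (𝓞 K)) (Φ : ℂ → ℂ),
      ∑ ψ : AddChar (Additive (ClassGroup (𝓞 K))) ℂ, ψ (Additive.ofMul Cl⁻¹) *
          ∑ ρ ∈ Function.update (fun _ ↦ (∅ : Finset ℂ)) ψ₁ {ρ₁} ψ, (famMult K ψ ρ : ℂ) * Φ ρ =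
        ψ₁ (Additive.ofMul Cl⁻¹) * Φ ρ₁ := by
  classical
  have hZ : ∀ ψ ρ, famF K ψ ρ = 0 → excRegion c K ρ →
      (((toMulHom ψ).toHomUnits = 1 → dedekindZeta₁ K ρ = 0) ∧
        ((toMulHom ψ).toHomUnits ≠ 1 → classGroupLFunction₀ K (toMulHom ψ).toHomUnits ρ = 0)) ∧
        1 - c₀ / (Real.log ((NumberField.discr K).natAbs : ℝ) + Real.log (|ρ.im| + 4)) < ρ.re := by
    intro ψ ρ h0 hexc
    refine ⟨famZ_of_famF_eq_zero ψ h0, lpRegion_mono hcc₀ ?_⟩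
    obtain ⟨him, hre⟩ := hexc
    rw [him, abs_zero, zero_add]; exact hre
  have hZ₁ := hZ ψ₁ ρ₁ h0₁ hexc₁
  refine ⟨?_, ?_, ?_⟩
  · intro ψ ρ hρ
    by_cases hψ : ψ = ψ₁
    · subst hψ
      rw [Function.update_self, Finset.mem_singleton] at hρ
      subst hρ; exact ⟨h0₁, hre₁, hre₁'⟩
    · rw [Function.update_of_ne hψ] at hρ; simp at hρ
  · intro ψ ρ h0 _ _ hexc
    obtain ⟨hχ, hρρ⟩ := hLPuniq _ _ ρ ρ₁ (hZ ψ ρ h0 hexc) hZ₁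
    have hψ : ψ = ψ₁ := toHomUnits_toMulHom_injective hχ
    subst hψ
    rw [Function.update_self, Finset.mem_singleton]; exact hρρ
  · intro Cl Φ
    rw [Finset.sum_eq_single ψ₁]
    · rw [Function.update_self, Finset.sum_singleton, hmult]; push_cast; ring
    · intro ψ _ hψ
      rw [Function.update_of_ne hψ, Finset.sum_empty, mul_zero]
    · intro h; exact absurd (Finset.mem_univ _) h

end Summit.QuantumAdvantage.QuantumAdvantage.Theorems.DegreeOnePrimesEscape

end
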